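import Summits.BirchSwinnertonDyer.BirchSwinnertonDyer.Theorems.ResidualThetaTransportAtTwoThetaLayerLambdaCongruenceAtTwoCuspSpanRowTools
import Mathlib.Data.Nat.Factorization.Basic
import HarnessLib

/-!
# Route `ResidualThetaTransportAtTwo`, node 27436 (cruxes Kan⁺ stmt-BirchSwinnertonDyer-20688 / Kμ⁺ 20689 / 21437), composite levels:
# **the row `B₃` is free** — at every odd level `N` prime to `3`, an admissible `χ` vanishing on `B₁` vanishes on every `γ` with `|b(γ)| = 3`

Cell `bsd-wall`, width seat `bsd-wall-rtt-p3-w2` g4 (2026-08-28). THEOREMS ONLY; `--supports stmt-BirchSwinnertonDyer-20688`; BSD is not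
proved by this. Context: at composite `N` the node is equivalent to the generation statement (G‴)_N «χ additive, killing small trace, the
`4^k`-classes and `B₁ = {b = −1}` ⟹ χ = 0» (w4 g2, `cuspSpanEvenAtTwo_of_forall_b1_odd`); at levels with three prime factors `B₁` does not
span and further ROWS `B_m = {b = −m}` are needed (rtt-p4-w2 g6 §3g); `B₂`, `B_{4^i}` are free (w4). Here: `B₃` is free whenever `3 ∤ N`
— by a `3`-ADIC TRIANGLE with the auxiliary prime chosen by Dirichlet + reciprocity, no Artin-type input.

CONSTRUCTION (`chi_eq_zero_of_apply_zero_one_eq_neg_three`). `γ = (a, −3; c, d)`; replacing `γ` by the companion `(−d, −3; c, −a)` (`γ·γ' = −I`)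
if necessary, `d ≡ 2 (mod 3)`. `χ γ` depends only on `(a, d) mod 3N` (§1). Let `w := v₂(φ(N))`; Dirichlet gives a prime
`n ≡ 2d⁻¹ (mod N)`, `n ≡ 2 (mod 3)`, `n ≡ 1 + 2^{w+2} (mod 2^{w+3})`; reciprocity `(3/n) = (n/3) = (2/3) = −1` gives `3^h ≡ −1 (mod n)`,
`h = (n−1)/2`, `2^w ∣ h`; with `T := h · (odd part of φ(N))`: `3^T ≡ −1 (mod n)`, `3^T ≡ 1 (mod N)` (Euler). Then `d* := (3^T + 1)/n ≡ d
(mod 3N)`, so `γ* := (a, −3; c*, d*)` has `χ γ* = χ γ`; the `B₁`-element `β'` with `d' := (3^{T−1} + c*)/d*` gives `(γ*β')₁₁ = 3^{T−1}` and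
`(γ*β')₀₁ · d* = −1 − 3·3^{T−1}`, whence `(γ*β')₁₀ ≡ d* ≡ 2 (mod 3)`; HENSEL (`exists_hensel_four` at `q = 3`, `e = 1`) gives `k ≥ 1` with
`3^{T−1} ∣ (γ*β')₁₀ + 4^k`, and a `B₁`-element `β₃` with `(γ*β'β₃)₁₁ = 4^k` exactly. So `χ γ = χ β' + χ β₃ + 0 = 0`.

Tools (§1 row values / companion, §2 the `β₃` step, §3 the auxiliary prime) are in `…CuspSpanRowTools`; here §4:
**`chi_eq_zero_of_apply_zero_one_eq_neg_three`**, `chi_eq_zero_of_natAbs_apply_zero_one_eq_three`.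

References: P. G. L. Dirichlet (1837) / Mathlib `PrimesInAP`; [Rademacher1929] §1; [Knapp1993] Prop. 11.1; [Pollack2003] Conj. 6.3.
-/

set_option autoImplicit false
set_option linter.dupNamespace false

open scoped MatrixGroups

open CongruenceSubgroup

namespace Summit.BirchSwinnertonDyer.BirchSwinnertonDyer.Theorems.SignedMuAtTwo

/-! ## §4. The row `B₃` is killed -/

section RowThree

variable {N : ℕ} [NeZero N] {χ : Gamma0 N → ZMod 2}

/-- **`B₃` is free (case `d ≡ 2 (mod 3)`).** `N` odd, `3 ∤ N`; `χ` additive, killing the small-trace elements, the `4^k`-classes and every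
`b = −1` element; `γ ∈ Γ₀(N)` with `b(γ) = −3` and `d(γ) ≡ 2 (mod 3)`: `χ γ = 0`. [cite: Rademacher1929, §1] [cite: Pollack2003, Conj. 6.3] -/
theorem chi_eq_zero_of_apply_zero_one_eq_neg_three_of_mod (hN : Odd N) (h3N : ¬ 3 ∣ N)
    (hadd : ∀ γ δ : Gamma0 N, χ (γ * δ) = χ γ + χ δ)
    (hsmall : ∀ γ : Gamma0 N, ((γ : SL(2, ℤ)) 0 0 + (γ : SL(2, ℤ)) 1 1).natAbs ≤ 2 → χ γ = 0)
    (hkill : ∀ γ : Gamma0 N, (∃ k : ℕ, 1 ≤ k ∧ ((γ : SL(2, ℤ)) 1 1).natAbs = 4 ^ k) → χ γ = 0)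
    (hB1 : ∀ β : Gamma0 N, (β : SL(2, ℤ)) 0 1 = -1 → χ β = 0)
    (γ : Gamma0 N) (hb : (γ : SL(2, ℤ)) 0 1 = -3) (hd3 : (γ : SL(2, ℤ)) 1 1 % 3 = 2) : χ γ = 0 := by
  have hN0 : N ≠ 0 := NeZero.ne N
  set a : ℤ := (γ : SL(2, ℤ)) 0 0 with hadef
  set d : ℤ := (γ : SL(2, ℤ)) 1 1 with hddef
  have hdet := Matrix.SpecialLinearGroup.det_coe (γ : SL(2, ℤ))
  rw [Matrix.det_fin_two, hb] at hdet
  -- `c = N c₀`, so `a d ≡ 1 (mod 3N)`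
  have hcN : (N : ℤ) ∣ (γ : SL(2, ℤ)) 1 0 := by
    have hmem := γ.2
    rw [Gamma0_mem] at hmem
    exact (ZMod.intCast_zmod_eq_zero_iff_dvd _ N).mp hmem
  obtain ⟨c₀, hc₀⟩ := hcN
  have had : a * d = 1 - 3 * N * c₀ := by rw [hadef, hddef]; linear_combination hdet - 3 * hc₀
  -- `d` is a unit mod `N`; its class
  have hdu : IsUnit ((d : ℤ) : ZMod N) := isUnit_gamma0_apply_one_one γ
  have hdcop : Nat.Coprime ((d : ℤ) : ZMod N).val N := by
    have := ZMod.val_coe_unit_coprime hdu.unit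
    rwa [IsUnit.unit_spec] at this
  -- `a₀ := 2 d⁻¹ mod N` as a natural number
  set a₀ : ℕ := ((2 : ZMod N) * ((a : ℤ) : ZMod N)).val with ha₀
  have haU : ((a : ℤ) : ZMod N) * ((d : ℤ) : ZMod N) = 1 := by
    have e1 := congrArg (Int.cast : ℤ → ZMod N) had
    push_cast at e1
    rw [ZMod.natCast_self] at e1
    linear_combination e1
  have h2u : IsUnit (2 : ZMod N) := by
    have : Nat.Coprime 2 N := Nat.coprime_two_left.mpr hN
    have h := (ZMod.isUnit_iff_coprime 2 N).mpr this
    exact_mod_cast h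
  have ha₀u : IsUnit ((a₀ : ℕ) : ZMod N) := by
    rw [ha₀, ZMod.natCast_zmod_val]
    exact h2u.mul (IsUnit.of_mul_eq_one _ haU)
  have ha₀cop : Nat.Coprime a₀ N := (ZMod.isUnit_iff_coprime a₀ N).mp ha₀u
  -- the period data: `φ(N) = 2^w · o₁`, `o₁` odd
  set w : ℕ := (Nat.totient N).factorization 2 with hw
  set o₁ : ℕ := ordCompl[2] (Nat.totient N) with ho₁
  have htot0 : Nat.totient N ≠ 0 := (Nat.totient_pos.mpr (Nat.pos_of_ne_zero hN0)).ne'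
  have hoφ : 2 ^ w * o₁ = Nat.totient N := Nat.ordProj_mul_ordCompl_eq_self _ _
  have ho₁odd : Odd o₁ := by
    rw [Nat.odd_iff]
    have := Nat.not_dvd_ordCompl Nat.prime_two htot0
    rw [← ho₁] at this; omega
  -- the auxiliary prime
  obtain ⟨n, hnprime, hngt, hna, hn3, hnw, hn4, hnh⟩ := exists_aux_prime_three hN h3N a₀ ha₀cop w
  have hn0 : n ≠ 0 := hnprime.ne_zero
  set h : ℕ := n / 2 with hhdef
  set T : ℕ := h * o₁ with hT
  have hh1 : 1 ≤ h := by have := hnprime.two_le; omega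
  have hT1 : 1 ≤ T := Nat.one_le_iff_ne_zero.mpr (Nat.mul_ne_zero (by omega) (by intro h0; rw [h0] at ho₁odd; exact absurd ho₁odd (by decide)))
  -- `3^T ≡ −1 (mod n)` and `3^T ≡ 1 (mod N)`
  have h3Tn : (3 : ZMod n) ^ T = -1 := by
    rw [hT, pow_mul, hnh]; exact ho₁odd.neg_one_pow
  have h3N' : Nat.Coprime 3 N := (Nat.Prime.coprime_iff_not_dvd Nat.prime_three).mpr h3N
  have h3TN : (3 : ZMod N) ^ T = 1 := by
    have hdvd : Nat.totient N ∣ T := by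
      rw [← hoφ, hT]
      exact Nat.mul_dvd_mul hnw dvd_rfl
    obtain ⟨m, hm⟩ := hdvd
    have h1 := Nat.ModEq.pow_totient h3N'
    have h2 := (ZMod.natCast_eq_natCast_iff _ _ _).mpr h1
    push_cast at h2
    rw [hm, pow_mul, h2, one_pow]
  -- `d* := (3^T + 1)/n`
  have hndvd : (n : ℤ) ∣ 3 ^ T + 1 := by
    rw [← ZMod.intCast_zmod_eq_zero_iff_dvd]; push_cast; rw [h3Tn]; ring
  obtain ⟨dstar, hdstar⟩ := hndvd
  -- `d* ≡ d (mod 3N)`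
  have hncastN : (n : ZMod N) = 2 * ((a : ℤ) : ZMod N) := by
    rw [(ZMod.natCast_eq_natCast_iff _ _ _).mpr hna, ha₀, ZMod.natCast_zmod_val]
  have hdsN : ((dstar : ℤ) : ZMod N) = ((d : ℤ) : ZMod N) := by
    have e1 := congrArg (Int.cast : ℤ → ZMod N) hdstar
    push_cast at e1
    rw [h3TN, hncastN] at e1
    -- `2 = 2 a d*` and `a d = 1`
    have e2 : (2 : ZMod N) * (((a : ℤ) : ZMod N) * ((dstar : ℤ) : ZMod N)) = 2 * 1 := by
      rw [mul_one]; linear_combination -e1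
    have e3 := h2u.mul_left_cancel e2
    calc ((dstar : ℤ) : ZMod N) = (((a : ℤ) : ZMod N) * ((d : ℤ) : ZMod N)) * ((dstar : ℤ) : ZMod N) := by
          rw [haU, one_mul]
      _ = ((d : ℤ) : ZMod N) * (((a : ℤ) : ZMod N) * ((dstar : ℤ) : ZMod N)) := by ring
      _ = ((d : ℤ) : ZMod N) := by rw [e3, mul_one]
  have hds3 : dstar % 3 = 2 := by
    -- `n d* = 3^T + 1 ≡ 1 (mod 3)`, `n ≡ 2 (mod 3)`
    have e1 : (n : ℤ) * dstar % 3 = 1 := by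
      rw [← hdstar]
      have : (3 : ℤ) ^ T = 3 * 3 ^ (T - 1) := by
        rw [← pow_succ']; congr 1; omega
      rw [this]; omega
    have e2 : (n : ℤ) % 3 = 2 := by exact_mod_cast hn3
    have : (n : ℤ) * dstar % 3 = ((n : ℤ) % 3) * (dstar % 3) % 3 := Int.mul_emod _ _ _
    rw [e2] at this
    omega
  have hNd : (N : ℤ) ∣ dstar - d := (ZMod.intCast_zmod_eq_zero_iff_dvd _ N).mp (by push_cast; rw [hdsN, sub_self])
  have h3d : (3 : ℤ) ∣ dstar - d := by omega
  have h3Nd : (N : ℤ) * (-3) ∣ dstar - d := by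
    rw [mul_neg, neg_dvd, mul_comm]
    have hc : IsCoprime (3 : ℤ) (N : ℤ) := by
      rw [show (3 : ℤ) = ((3 : ℕ) : ℤ) by norm_num, Nat.isCoprime_iff_coprime]; exact h3N'
    exact hc.mul_dvd h3d hNd
  -- the companion row element `γ* = (a, −3; c*, d*)`
  have hads : (N : ℤ) * 3 ∣ 1 - a * dstar := by
    have : 1 - a * dstar = 3 * N * c₀ - a * (dstar - d) := by linear_combination -had
    rw [this]
    exact dvd_sub ⟨c₀, by ring⟩ (by rw [mul_comm (N : ℤ)] ; exact (Dvd.dvd.mul_left (by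
      have := h3Nd; rw [show (N : ℤ) * -3 = -(3 * N) by ring, neg_dvd] at this; exact this) a))
  obtain ⟨cstar₀, hcstar₀⟩ := hads
  -- `c* := N c*₀` with `a d* + 3 (N c*₀) = 1`
  obtain ⟨γs, hs00, hs01, hs10, hs11⟩ := ThetaLayerLambdaCongruenceAtTwo.exists_gamma0_entries (N := N)
    a (-3) ((N : ℤ) * cstar₀) dstar (by linear_combination -hcstar₀) (dvd_mul_right _ _)
  have hγs : χ γ = χ γs := chi_eq_of_row hadd hsmall (b := -3) (by norm_num) hb hs01
    (by rw [hs00, hadef, sub_self]; exact dvd_zero _) (by rw [hs11]; exact h3Nd)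
  -- `β'` with `d' := (3^{T−1} + c*)/d*`
  have hTsplit : (3 : ℤ) ^ T = 3 * 3 ^ (T - 1) := by rw [← pow_succ']; congr 1; omega
  have hdsdvd : dstar ∣ 3 ^ (T - 1) + (N : ℤ) * cstar₀ := by
    -- `3 (3^{T−1} + N c*₀) = 3^T + 1 − a d* = n d* − a d* + ... `: from `n d* = 3^T + 1` and `a d* + 3 N c*₀ = 1`
    have e1 : 3 * (3 ^ (T - 1) + (N : ℤ) * cstar₀) = dstar * ((n : ℤ) - a) := by
      linear_combination -hTsplit + hdstar - hcstar₀
    have h3ds : IsCoprime (3 : ℤ) dstar := by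
      have hm : dstar = 3 * (dstar / 3) + 2 := by omega
      exact ⟨-(2 * (dstar / 3) + 1), 2, by linear_combination (2 : ℤ) * hm⟩
    have : dstar ∣ 3 * (3 ^ (T - 1) + (N : ℤ) * cstar₀) := ⟨(n : ℤ) - a, e1⟩
    exact h3ds.symm.dvd_of_dvd_mul_left this
  obtain ⟨d', hd'⟩ := hdsdvd
  have hd'cop : IsCoprime d' (N : ℤ) := by
    -- `d* d' = 3^{T−1} + N c*₀`, and `3` is prime to `N`
    have h1 : IsCoprime (dstar * d') (N : ℤ) := by
      rw [← hd']
      have hc : IsCoprime ((3 : ℤ) ^ (T - 1)) (N : ℤ) := by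
        apply IsCoprime.pow_left
        rw [show (3 : ℤ) = ((3 : ℕ) : ℤ) by norm_num, Nat.isCoprime_iff_coprime]; exact h3N'
      exact hc.add_mul_left_left cstar₀
    exact h1.of_mul_left_right
  obtain ⟨α', κ', hak'⟩ := hd'cop
  obtain ⟨β', -, hb01, -, hb11⟩ := ThetaLayerLambdaCongruenceAtTwo.exists_gamma0_entries (N := N)
    α' (-1) ((N : ℤ) * κ') d' (by linear_combination hak') (dvd_mul_right _ _)
  -- entries of `g₁ := γ* β'`: `D = 3^{T−1}`, `B d* = −1 − 3 D`
  set D : ℤ := (3 : ℤ) ^ (T - 1) with hDdef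
  have hD : ((γs * β' : Gamma0 N) : SL(2, ℤ)) 1 1 = D := by
    rw [gamma0_mul_apply_one_one', hs10, hs11, hb01, hb11]; linear_combination -hd'
  have hB : ((γs * β' : Gamma0 N) : SL(2, ℤ)) 0 1 = -a - 3 * d' := by
    rw [gamma0_mul_apply_zero_one, hs00, hs01, hb01, hb11]; ring
  have hBd : ((γs * β' : Gamma0 N) : SL(2, ℤ)) 0 1 * dstar = -1 - 3 * D := by
    rw [hB]; linear_combination hcstar₀ + 3 * hd'
  set C : ℤ := ((γs * β' : Gamma0 N) : SL(2, ℤ)) 1 0 with hCdef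
  have hdet1 := Matrix.SpecialLinearGroup.det_coe ((γs * β' : Gamma0 N) : SL(2, ℤ))
  rw [Matrix.det_fin_two, hD, ← hCdef] at hdet1
  -- Hensel at `q = 3`: `k ≥ 1` with `3^{T−1} ∣ 4^k − (−C)`
  obtain ⟨e, he1, he3, hens⟩ := exists_hensel_four 3 Nat.prime_three (by norm_num)
  have he : e = 1 := by
    have h15 : (3 : ℤ) ^ e ∣ 15 := by norm_num at he3; exact he3
    by_contra hne
    have h2 : 2 ≤ e := by omega
    have h9 : (3 : ℤ) ^ 2 ∣ 15 := (pow_dvd_pow (3 : ℤ) h2).trans h15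
    norm_num at h9
  subst he
  have hx : (3 : ℤ) ^ (min 1 (T - 1)) ∣ (-C) - 1 := by
    by_cases hT2 : T - 1 = 0
    · rw [hT2]; simp
    · rw [min_eq_left (by omega), pow_one]
      -- `3 ∣ D`, so `−B C ≡ 1` and `B d* ≡ −1 (mod 3)` give `C ≡ d* ≡ 2 (mod 3)`
      have h3D : (3 : ℤ) ∣ D := by rw [hDdef]; exact dvd_pow_self 3 hT2
      set B : ℤ := ((γs * β' : Gamma0 N) : SL(2, ℤ)) 0 1 with hBdef
      have e1 : (3 : ℤ) ∣ B * (C - dstar) := by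
        have : B * (C - dstar) = (((γs * β' : Gamma0 N) : SL(2, ℤ)) 0 0 + 3) * D := by
          linear_combination -hdet1 - hBd
        rw [this]; exact Dvd.dvd.mul_left h3D _
      have h3B : ¬ (3 : ℤ) ∣ B := by
        intro h
        have : (3 : ℤ) ∣ 1 := by
          have e2 : (1 : ℤ) = ((γs * β' : Gamma0 N) : SL(2, ℤ)) 0 0 * D - B * C := by linear_combination -hdet1
          rw [e2]; exact dvd_sub (Dvd.dvd.mul_left h3D _) (Dvd.dvd.mul_right h _)
        omega
      have h3p : Prime (3 : ℤ) := Int.prime_three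
      have e2 : (3 : ℤ) ∣ C - dstar := (h3p.dvd_or_dvd e1).resolve_left h3B
      have : (-C) - 1 = -(C - dstar) - (dstar + 1) := by ring
      rw [this]
      exact dvd_sub (dvd_neg.mpr e2) (by omega)
  obtain ⟨k, hk1, hk⟩ := hens (T - 1) (-C) hx
  -- `β₃` with `(g₁ β₃)₁₁ = 4^k`
  have hdvd : ((γs * β' : Gamma0 N) : SL(2, ℤ)) 1 1 ∣ ((γs * β' : Gamma0 N) : SL(2, ℤ)) 1 0 + 4 ^ k := by
    rw [hD, ← hCdef]
    have : C + 4 ^ k = 4 ^ k - -C := by ring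
    rw [this]; exact hk
  obtain ⟨β₃, hb3, h4⟩ := exists_b1_mul_apply_one_one_eq_four_pow hN (γs * β') k hdvd
  have hkilled : χ (γs * β' * β₃) = 0 := hkill _ ⟨k, hk1, by rw [h4, Int.natAbs_pow]; rfl⟩
  rw [hadd, hadd, hB1 β' hb01, hB1 β₃ hb3, add_zero, add_zero] at hkilled
  rw [hγs, hkilled]

/-- **The row `B₃` is free**: `N` odd, `3 ∤ N`, `χ` additive killing the small-trace elements, the `4^k`-classes and every `b = −1` element;
then `χ γ = 0` for every `γ ∈ Γ₀(N)` with `b(γ) = −3`. [cite: Rademacher1929, §1] [cite: Pollack2003, Conj. 6.3] -/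
theorem chi_eq_zero_of_apply_zero_one_eq_neg_three (hN : Odd N) (h3N : ¬ 3 ∣ N)
    (hadd : ∀ γ δ : Gamma0 N, χ (γ * δ) = χ γ + χ δ)
    (hsmall : ∀ γ : Gamma0 N, ((γ : SL(2, ℤ)) 0 0 + (γ : SL(2, ℤ)) 1 1).natAbs ≤ 2 → χ γ = 0)
    (hkill : ∀ γ : Gamma0 N, (∃ k : ℕ, 1 ≤ k ∧ ((γ : SL(2, ℤ)) 1 1).natAbs = 4 ^ k) → χ γ = 0)
    (hB1 : ∀ β : Gamma0 N, (β : SL(2, ℤ)) 0 1 = -1 → χ β = 0)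
    (γ : Gamma0 N) (hb : (γ : SL(2, ℤ)) 0 1 = -3) : χ γ = 0 := by
  have hdet := Matrix.SpecialLinearGroup.det_coe (γ : SL(2, ℤ))
  rw [Matrix.det_fin_two, hb] at hdet
  -- `3 ∤ d`, so `d ≡ 1` or `2 (mod 3)`
  have hd3 : (γ : SL(2, ℤ)) 1 1 % 3 = 1 ∨ (γ : SL(2, ℤ)) 1 1 % 3 = 2 := by
    have : ¬ (3 : ℤ) ∣ (γ : SL(2, ℤ)) 1 1 := by
      intro h
      have : (3 : ℤ) ∣ 1 := by
        rw [← hdet]; exact dvd_sub (Dvd.dvd.mul_left h _) ⟨-(γ : SL(2, ℤ)) 1 0, by ring⟩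
      omega
    omega
  rcases hd3 with h1 | h2
  · -- pass to the companion `(−d, −3; c, −a)`, whose lower-right entry `−a ≡ 2 (mod 3)` (`a d ≡ 1`)
    obtain ⟨γ', h00, h01, h11, hχ⟩ := exists_companion hadd hsmall γ
    rw [← hχ]
    refine chi_eq_zero_of_apply_zero_one_eq_neg_three_of_mod hN h3N hadd hsmall hkill hB1 γ' (by rw [h01, hb]) ?_
    rw [h11]
    have had : (γ : SL(2, ℤ)) 0 0 * (γ : SL(2, ℤ)) 1 1 % 3 = 1 := by
      have : (γ : SL(2, ℤ)) 0 0 * (γ : SL(2, ℤ)) 1 1 = 1 + (-3) * (γ : SL(2, ℤ)) 1 0 := by linear_combination hdet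
      rw [this]; omega
    have := Int.mul_emod ((γ : SL(2, ℤ)) 0 0) ((γ : SL(2, ℤ)) 1 1) 3
    rw [h1] at this
    omega
  · exact chi_eq_zero_of_apply_zero_one_eq_neg_three_of_mod hN h3N hadd hsmall hkill hB1 γ hb h2

/-- **The row `B₃` is free, `|b| = 3`** (for `b = +3` pass to `γ⁻¹`). [cite: Rademacher1929, §1] [cite: Pollack2003, Conj. 6.3] -/
theorem chi_eq_zero_of_natAbs_apply_zero_one_eq_three (hN : Odd N) (h3N : ¬ 3 ∣ N)
    (hadd : ∀ γ δ : Gamma0 N, χ (γ * δ) = χ γ + χ δ)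
    (hsmall : ∀ γ : Gamma0 N, ((γ : SL(2, ℤ)) 0 0 + (γ : SL(2, ℤ)) 1 1).natAbs ≤ 2 → χ γ = 0)
    (hkill : ∀ γ : Gamma0 N, (∃ k : ℕ, 1 ≤ k ∧ ((γ : SL(2, ℤ)) 1 1).natAbs = 4 ^ k) → χ γ = 0)
    (hB1 : ∀ β : Gamma0 N, (β : SL(2, ℤ)) 0 1 = -1 → χ β = 0) :
    ∀ γ : Gamma0 N, ((γ : SL(2, ℤ)) 0 1).natAbs = 3 → χ γ = 0 := by
  intro γ hb
  rcases Int.natAbs_eq_natAbs_iff.mp (show ((γ : SL(2, ℤ)) 0 1).natAbs = (3 : ℤ).natAbs from hb) with h | h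
  · -- `b = 3`: use the inverse
    have hinv : ((γ⁻¹ : Gamma0 N) : SL(2, ℤ)) 0 1 = -3 := by
      have e : ((γ⁻¹ : Gamma0 N) : SL(2, ℤ)) 0 1 = -((γ : SL(2, ℤ)) 0 1) := by
        rw [InvMemClass.coe_inv, Matrix.SpecialLinearGroup.SL2_inv_expl]; rfl
      rw [e, h]
    rw [← map_inv_eq_of_additive hadd γ]
    exact chi_eq_zero_of_apply_zero_one_eq_neg_three hN h3N hadd hsmall hkill hB1 γ⁻¹ hinv
  · exact chi_eq_zero_of_apply_zero_one_eq_neg_three hN h3N hadd hsmall hkill hB1 γ h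

end RowThree

end Summit.BirchSwinnertonDyer.BirchSwinnertonDyer.Theorems.SignedMuAtTwo
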